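import Summits.QuantumFields.YangMills.Theorems.BalabanUVNodesN27AtAllPinsOfRecord13CoPHVCutFSC
import Summits.QuantumFields.YangMills.Theorems.BalabanUVNodesN19RateEdgeHolderD4AtN16PinnedReadingFSC
import Summits.QuantumFields.YangMills.Theorems.BalabanUVNodesN18PolLimitRateOfGeometricIncrements

/-!
# BalabanUVNodes ∕ N27 = binder B5 AT THE RECORD — storey APW: K3⁷ v5 (941dddb108cbaacf) AT ALL ITS PINS WITH EVERY REMAINING SLOT AT ITS PRODUCER — the four reading pins, the spine pin
# `crOfRecord₁₃VAt K₀ (jc …) sh` read per tuple, the rates' `PHolderD4 β` body from the pins + letter rows + dag-n18-w2's finite-volume kernel door, N20 ∕ N21 keyed witnesses, N27x a theorem, and the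
# N19′ CORE EDGE ⟸ dag-n19-w3 g3's N16-PINNED LINK READING `keyedCoreEdgeHolderD4_of_linkReadingAtN16PinnedReading` (`…N19RateEdgeHolderD4AtN16PinnedReadingFSC` p607220) AT THE PINNED SPINE
# READING — the v5 analogue of BPP `…N27AtBothPinsOfRecord13CoPHVCutProducers` (p598486: v3, two pins, ∀-`g₀`); composed per guarded admissible tuple by dag-n19-w3's FSC composer
# `keyedGuarded₁₃CoPH_of_keyedFacesP_fsc` (p595910 = v5's composition step)
# (cell `pub-ymgap`, HUMAN RULING D-0062 Track A, R134 seat `pub-ymgap-dag-n27-c` (N27 B5 composite, s2) gen 13, HOME trigger (t2⁗) «a producer face in a NEW currency at the pinned reading»: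
# dag-n19-w3 g3 FILED-2 l.≈29380; K3⁷ `SpineGivenEndpointR13SepCoPH` = stmt-QuantumFields-20544, `--kind proof --supports 20544 --as helper`; COUNT-NEUTRAL; THEOREMS ONLY, 0 `def`, 0 `sorry`;
# `N`-generic, `K₀`-generic, regime-generic, NO Theses import, does NOT import the skeleton or its mirror (v5's local `U3PinnedKernels ∕ N15PinnedSized ∕ N16RadiusMatch ∕ PHolderD4 ∕ rrOfRecord ∕
# LiveSel` are SPELLED; `Ne1PinnedOfRecord ∕ N16PinnedLoose ∕ N16LettersEnd` are the tree defs v5 itself imports) — item faces in leaf `…N27SpineGivenEndpointR13SepCoPHAllPinsOfRecordVLinkReading`)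

WHAT IS KERNEL-CHECKED ([bookkeeping]; ONE application per regime of the FSC composer at the pinned spine reading: `h20`∕`h21` ⟸ keyed witnesses by dag-n20-d's `relWeightBound_∕shellWeightBound_crOfRecord₁₃VAt`;
`hrates` ⟸ (Kꜰ) §1 `pHolderD4Body_rateCarriers_of_kernels_pin` per tuple and `g₀` from the rows discharged behind the pins (`n14At_rateCarriersOfRecord₁₃CoPH_of_pinned`,
`n15At_fullGSizedObjects_family`, `rateCarriers_ne3_of_pinnedLoose` + `h16`), the letter rows and `u3KernelInputs_of_finiteVolumeLetters` (`ForSmallCouplings.of_forall` — the pins' rows need no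
tuning); `h19` ⟸ dag-n19-w3's ★★★ at `cr :=` the pinned reading; `hx` ⟸ UC §0 `keyedExtraction_crOfRecord₁₃VAt_cut` under `hsel`, `hζm` with (H-U) ∕ `0 ≤ ζ` supplied).
* §1 ★★★ `spine_rec13CCoPHOn_of_v5pins_linkReading_fsc_at_crOfRecord₁₃VAt_cut` — any regime `Rg`, `hsel` per tuple ⇒ `Spine` at `IsRecordOfRecord₁₃CCoPHOn F N Rg`.  Displayed, and NOTHING
  ELSE: the four pins `hpin1 hpin2 hpinL hpin` · `h16` · `hs hκ hcr hρ` · `hr hinc hS h9 hW` · v5's other two N16 rows `hmatch` (= `N16RadiusMatch ℓ₃ B` spelled) and `hend : N16LettersEnd N g ℓ₃` ·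
  `hβ1 : β ≤ 1` · K1⁷'s interval-form window `hβw` · node U3's uniform letters `hunif` · `hsel hζm` · keyed N20 ∕ N21 witnesses `h20 h21` · NODE O's N16-pinned LINK READING `hlink` at the pinned
  spine reading (dag-n19-w3's hypothesis verbatim, `S :=` the pinned reading's carriers).
* (no live-line edition in this file — the 400-line cap; the leaf instantiates §1 at `Rg := guard ∧ LiveSel`, `hsel := ⟨_, hRg.2⟩` directly.)
Consumed BY NAME: UC p595448 §0; dag-n20-d p590105 ∕ p587226; node00-def-K0c `localBgMeasurable`; dag-n20-w2 `zeta_nonneg_of_provisos₁₃CoPH`; dag-n19-w3 p595910 + p607220 (and through it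
`…AtN16PinnedReading`, `…AtTuningWindow`, J's facts); dag-n27-w1 (Kꜰ) §1 p602540; dag-n18-w2 p606911; dag-n14-w1 ∕ dag-n15-a ∕ dag-n16-e pins and faces.  Nothing landed is edited or re-declared.

HONEST FRAMING.  COMPOSITE-node bookkeeping BY NAME; a REDUCTION, not a discharge; every displayed antecedent is a HYPOTHESIS inhabited for no family today (K0⁷ `Record13SepCoPHInhabited`
OPEN) or a decided MODEL behind a pin (n14-w1's datum-reading tower; dag-n15-a's model-level sized objects); `hlink` is NODE O's world at the runs of record (link-reading ledger, N11's (iii), N14's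
positional ∕ dressed rows, the remaining (v′-16)∕(v′-17) rows, the tube bracket) — UNPRINTED content for d = 4, 0 instances; K1⁷'s window `hβw` = `stub_betaWindow13PWS`'s currency (K1⁷ OPEN);
`hunif` a uniform-letters clause on the free `𝔯`; N16 at the loose-data object = THE END's content (hypothesis); the finite-volume kernel letters are Bałaban-type SHAPES NOT PRINTED as such for
d = 4; NE7b ∕ NE7c witnesses 0∕1 today; `jc sh ℓ s r ℓ₃ g B 𝔯 β ksel` FREE PARAMETERS (no reading minted); nothing of Bałaban's asserted or instantiated; NOT `stub_rates13H` ∕ `stub_expansion13H`;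
N14–N22 ∕ N27 NOT discharged (the chair books, R417); K3⁷ OPEN, NOT claimed; skeleton v5 untouched; counts UNMOVED (typed 28∕28 · discharged 5∕27, A 5∕28); one finite four-torus programme at
fixed `ε` — NOT ℝ⁴, NOT infinite volume, NOT OS, NOT a mass gap, NOT Clay.  No decl below carries a cite tag.
-/

set_option autoImplicit false

namespace Summit.QuantumFields.YangMills.Theorems.BalabanUVNodesN27SpineRecord

open scoped BigOperators Matrix Matrix.Norms.L2Operator
open Finset MeasureTheory
open Literature.MathematicalPhysics.QuantumFieldTheory.Balaban1983to89
open T4OutputRate T4RecentScale T4GoodClassBudget T4CauchySum T4TowerRateComposition T4TowerRateDischarge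
open T4EtaRateMin (Readings NE3Shape)
open T4RateLiaison (GaugeDominated)
open FlowStep (RGEqH prefixOf)
open TreeLengthTorus (TFaceConnected torusTreeLen)
open B12TreeDecay (kappa₀)
open Summit.QuantumFields.BalabanUV.T4Continuum
open AveragingDeficitDualResidual (dualC1 dualC2)
open AveragingDeficitDerivWallProof (wallConst)
open AveragingDeficitPeriodicCounting (IsPeriodicDir)
open MinimalActionSandwich (IsMinimiser minAct)
open MinimalActionRate (sfClass)
open MinimalActionRefine (RegularSup gradConst)
open NE3EnergyShapes (IsUnitarySite IsPeriodicSite)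
open NE3.LeafIndexSockets (LeafH3sup)
open Summit.QuantumFields.BalabanUV.T4Continuum.Spine
open Summit.QuantumFields.BalabanUV.T4Continuum.Spine.NE4 (runFlow)
open Summit.QuantumFields.BalabanUV.T4Continuum.NE1p.DressedRoot (DressedTower DressedStabilityStrict)
open Summit.QuantumFields.YangMills.BalabanUVNodes.N19LedgerLinkSync (LedgerDataSync LedgerAtSync)
open YMDAG.UVSplit
open Summit.QuantumFields.YangMills.BalabanUVNodes.N16HolderDefs (CovRootHolder N16HolderAt)
open Summit.QuantumFields.YangMills.BalabanUVNodes.SpineRatesHolder (RatesHolderAt)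
open Literature.MathematicalPhysics.QuantumFieldTheory.Balaban1983to89.T4Continuum (T4Family ULoop)
open Node00 (Stage13HParams datumOfRecord₁₃CoPH SiteSeqKey U3Letters₁₁ NE3Letters₁₁ ne3ConstLayerOfRecord₁₁ ne3NperOfRecord₁₁ ne3DomOfRecord₁₁ ZetaMeasurable ppSelLiveOfRecord
  EOfRecord₁₃ wOfRecord₉ localBgMeasurable)
open Literature.MathematicalPhysics.QuantumFieldTheory.Balaban1983to89.B12Sec2to5 (betaPrime510)
open Literature.MathematicalPhysics.QuantumFieldTheory.Balaban1983to89.Node00.U3OfKernels (objectsOfRecord₁₃ KernelDecayOfRecord₁₃)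
open Literature.MathematicalPhysics.QuantumFieldTheory.Balaban1983to89.Node00.U3KernelLetters (GeometricIncrementsOfRecord₁₃ WindowedNE9OfRecord₁₃ WindowedDecayOfRecord₁₃
  WindowedStepRateOfRecord₁₃)
open Summit.QuantumFields.YangMills.BalabanUVNodes.N16PinnedLayer13CoPH (N16PinnedLoose N16LettersEnd rateCarriers_ne3_of_pinnedLoose)
open T4WeightBudget (RelWeightBound)
open T4IndicatorShell (ShellWeightBound)
open T4ContinuumYM4Torus (ForSmallCouplings)
open T4ApexHybrid (HybridNE7Under)
open Summit.QuantumFields.YangMills.BalabanUVNodes.N19CoreEdgeFSCComposer (keyedGuarded₁₃CoPH_of_keyedFacesP_fsc)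
open Summit.QuantumFields.YangMills.BalabanUVNodes.N19RateEdgeHolderD4AtN16PinnedReadingFSC (keyedCoreEdgeHolderD4_of_linkReadingAtN16PinnedReading)
open Summit.QuantumFields.YangMills.BalabanUVNodes.SpineCanonicalWeights (core_nonneg_of_shellWeightBound)
open Summit.QuantumFields.YangMills.BalabanUVNodes.N19TargetClassWeightsE1Keyed
open Summit.QuantumFields.YangMills.BalabanUVNodes.N21KeyedShellWeightShellZero (zeta_nonneg_of_provisos₁₃CoPH)
open YMDAG.N14.TopBorn (Ne1PinnedOfRecord n14At_rateCarriersOfRecord₁₃CoPH_of_pinned)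
open Summit.QuantumFields.YangMills.BalabanUVNodes.N15.GenuineRecord (fullGSizedObjects n15At_fullGSizedObjects_family)
open Summit.QuantumFields.YangMills.BalabanUVNodes.N15.AtKeyedHome (neZero_blockFactor)
open YMDAG.N18.PolLimitRate (u3KernelInputs_of_finiteVolumeLetters)

variable {N : ℕ} [NeZero N] (K₀ : ℕ)
  (jc : (F : T4Family) → (θ : Stage13HParams F N) → θ.Provisos₁₃CoPH F N → (ℕ → ℝ) → List (ULoop F) → ℕ → ℕ)
  (sh : ShellSplit₁₃CoPH N K₀) (β : ℝ) (𝔯 : RateReading₁₃CoPH N)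
  (ℓ : (F : T4Family) → Stage13HParams F N → U3Letters₁₁) (s : (F : T4Family) → Stage13HParams F N → ℕ) (r : (F : T4Family) → Stage13HParams F N → ℝ)
  (ℓ₃ : T4Family → NE3Letters₁₁) (g B : T4Family → ℝ)

/-! ## §1 Every v5 slot at its producer, K5 at the per-tuple-cut spine reading of record, N19′ ⟸ the N16-pinned LINK READING at that reading (any regime, `hsel` per tuple) -/

/-- ★★★ **N27 = B5 AT THE REGIME RECORD CLASS — K3⁷ v5 AT ALL ITS PINS WITH EVERY REMAINING SLOT AT ITS PRODUCER**: dag-n19-w3's FSC composer `keyedGuarded₁₃CoPH_of_keyedFacesP_fsc`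
(p595910 = v5's composition step) at the PINNED spine reading `fun F θ hP g₀ os ↦ crOfRecord₁₃VAt K₀ (jc F θ hP g₀ os) sh F θ hP g₀ os` with: the rates `P := PHolderD4 β` body supplied per
tuple by (Kꜰ) §1 `pHolderD4Body_rateCarriers_of_kernels_pin` from the FOUR v5 reading pins (`hpin1 hpin2 hpinL hpin`; rows discharged behind them as in AP §2), `h16`, the U3 letter rows
`hs hκ hcr hρ` and dag-n18-w2's finite-volume door (`hr hinc hS h9 hW` ⇒ `hdec h18 h22`, `u3KernelInputs_of_finiteVolumeLetters`); N20 ∕ N21 from keyed witnesses `h20 h21` by dag-n20-d's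
transfers; N27x a THEOREM (UC §0 `keyedExtraction_crOfRecord₁₃VAt_cut` under `hsel`, `hζm`; (H-U) ∕ `0 ≤ ζ` supplied); and the N19′ face ⟸ dag-n19-w3's ★★★
`keyedCoreEdgeHolderD4_of_linkReadingAtN16PinnedReading` (`…N19RateEdgeHolderD4AtN16PinnedReadingFSC` p607220) AT THIS READING from v5's three N16 rows (`hpinL`, `hmatch` = `N16RadiusMatch ℓ₃ B`
spelled, `hend : N16LettersEnd N g ℓ₃`), `hβ1 : β ≤ 1`, K1⁷'s interval-form window `hβw`, node U3's uniform letters `hunif`, and NODE O's N16-pinned LINK READING `hlink` AT THE PINNED SPINE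
READING (dag-n19-w3's displayed hypothesis verbatim with `S := crOfRecord₁₃VAt K₀ (jc …) sh …`; 0 instances in the tree).  So B5 at `IsRecordOfRecord₁₃CCoPHOn F N Rg` costs EXACTLY the
displayed rows — pins · `h16` · letter rows · finite-volume kernel letters · `hβ1 hmatch hend hβw hunif` · `hsel hζm` · keyed `h20 h21` · `hlink` — and NOTHING parametric is left: every
K4 ∕ K5 slot of v5 is at its producer's deepest landed currency.  Every row a HYPOTHESIS or a decided MODEL (0∕1 today; K0⁷ OPEN); `hlink` = NODE O's world (UNPRINTED content); nothing
of Bałaban's proved; NOT `stub_rates13H` ∕ `stub_expansion13H`; no node discharged. [bookkeeping] -/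
theorem spine_rec13CCoPHOn_of_v5pins_linkReading_fsc_at_crOfRecord₁₃VAt_cut (Rg : (F : T4Family) → Stage13HParams F N → Prop)
    (ksel : (F : T4Family) → (θ : Stage13HParams F N) → θ.Provisos₁₃CoPH F N → (ℕ → ℝ) → List (ULoop F) → ℕ)
    (hpin1 : Ne1PinnedOfRecord 𝔯)
    (hpin2 : ∃ (b aS : ℝ) (ν μ α β' : Fin 4) (c35 p : ℝ), 0 < b ∧ 0 < aS ∧
      ∀ (F : T4Family) (θ : Stage13HParams F N) (hP : θ.Provisos₁₃CoPH F N) (g₀ : ℕ → ℝ) (os : List (ULoop F)) (k : ℕ),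
        (𝔯.lit F θ hP g₀ os).ne2 k = haveI := neZero_blockFactor F; fullGSizedObjects 3 F.hL b aS ν μ α β' c35 p)
    (hpinL : N16PinnedLoose 𝔯 ℓ₃ B)
    (hpin : ∀ (F : T4Family) (θ : Stage13HParams F N) (hP : θ.Provisos₁₃CoPH F N) (g₀ : ℕ → ℝ) (os : List (ULoop F)),
      (𝔯.lit F θ hP g₀ os).u3 = objectsOfRecord₁₃ F N θ.toStage13Params (ℓ F θ))
    (h16 : ∀ (F : T4Family), (∃ θ : Stage13HParams F N, θ.Provisos₁₃CoPH F N ∧ Rg F θ ∧ θ.Admissible F N) →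
      N16HolderAt (ne3OfRecord₁₁ F { ne3ConstLayerOfRecord₁₁ F N (ℓ₃ F) with
        dom := {V | V ∈ ne3DomOfRecord₁₁ F N 0 0 ∧ V ∈ sfClass 4 F.L (ne3NperOfRecord₁₁ F 0 0) ((ℓ₃ F).ε / B F) 0} }) β)
    (hs : ∀ (F : T4Family) (θ : Stage13HParams F N), θ.Provisos₁₃CoPH F N → Rg F θ → θ.Admissible F N → (ℓ F θ).Signs)
    (hκ : ∀ (F : T4Family) (θ : Stage13HParams F N), θ.Provisos₁₃CoPH F N → Rg F θ → θ.Admissible F N → 0 < (ℓ F θ).κ)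
    (hcr : ∀ (F : T4Family) (θ : Stage13HParams F N), θ.Provisos₁₃CoPH F N → Rg F θ → θ.Admissible F N →
      betaPrime510 4 1 (ℓ F θ).κ ≤ (ℓ F θ).cr)
    (hρ : ∀ (F : T4Family) (θ : Stage13HParams F N), θ.Provisos₁₃CoPH F N → Rg F θ → θ.Admissible F N →
      0 ≤ (ℓ F θ).ρ ∧ (ℓ F θ).ρ < 1)
    (hr : ∀ (F : T4Family) (θ : Stage13HParams F N), θ.Provisos₁₃CoPH F N → Rg F θ → θ.Admissible F N → r F θ < 1)
    (hinc : ∀ (F : T4Family) (θ : Stage13HParams F N), θ.Provisos₁₃CoPH F N → Rg F θ → θ.Admissible F N →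
      GeometricIncrementsOfRecord₁₃ F N θ.toStage13Params (r F θ))
    (hS : ∀ (F : T4Family) (θ : Stage13HParams F N), θ.Provisos₁₃CoPH F N → Rg F θ → θ.Admissible F N →
      WindowedStepRateOfRecord₁₃ F N θ.toStage13Params (s F θ) (ℓ F θ).κ (ℓ F θ).θ₅ ((ℓ F θ).C₅ * (ℓ F θ).θ₅))
    (h9 : ∀ (F : T4Family) (θ : Stage13HParams F N), θ.Provisos₁₃CoPH F N → Rg F θ → θ.Admissible F N →
      WindowedNE9OfRecord₁₃ F N θ.toStage13Params (ℓ F θ).κ (ℓ F θ).moduli)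
    (hW : ∀ (F : T4Family) (θ : Stage13HParams F N), θ.Provisos₁₃CoPH F N → Rg F θ → θ.Admissible F N →
      WindowedDecayOfRecord₁₃ F N θ.toStage13Params 0 1 (ℓ F θ).κ)
    (hβ1 : β ≤ 1)
    (hmatch : ∀ F : T4Family, 0 < B F ∧ (ℓ₃ F).ε / B F ≤ (ℓ₃ F).b)
    (hend : N16LettersEnd N g ℓ₃)
    (hβw : ∀ (F : T4Family) (θ : Stage13HParams F N) (hP : θ.Provisos₁₃CoPH F N), Rg F θ → θ.Admissible F N →
      ∃ γ₀ b b' : ℝ, 0 < γ₀ ∧ 0 < b ∧ DagBinding.BetaBoundsInInterval (datumOfRecord₁₃CoPH F N θ hP).C.toB12 γ₀ b b')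
    (hunif : ∀ (F : T4Family) (θ : Stage13HParams F N) (hP : θ.Provisos₁₃CoPH F N), Rg F θ → θ.Admissible F N →
      ∃ M ρ₁ : ℝ, 0 ≤ M ∧ ρ₁ < 1 ∧ ∀ (g₀ : ℕ → ℝ) (os : List (ULoop F)) (k : ℕ), 0 < (rateCarriersOfRecord₁₃CoPH 𝔯 F θ hP g₀ os k).u3.ρ ∧
        (rateCarriersOfRecord₁₃CoPH 𝔯 F θ hP g₀ os k).u3.ρ ≤ ρ₁ ∧
        (rateCarriersOfRecord₁₃CoPH 𝔯 F θ hP g₀ os k).u3.cr * (rateCarriersOfRecord₁₃CoPH 𝔯 F θ hP g₀ os k).u3.C₉ * (rateCarriersOfRecord₁₃CoPH 𝔯 F θ hP g₀ os k).u3.ω ≤ M)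
    (hsel : ∀ (F : T4Family) (θ : Stage13HParams F N), θ.Provisos₁₃CoPH F N → Rg F θ → θ.Admissible F N →
      ∃ E : B12.RunParams → ℝ, θ.ppSel = ppSelLiveOfRecord F N θ.ν θ.τ9 E (wOfRecord₉ F N θ.toStage9Params))
    (hζm : ∀ (F : T4Family) (θ : Stage13HParams F N), θ.Provisos₁₃CoPH F N → Rg F θ → θ.Admissible F N → ZetaMeasurable F N θ.ζ)
    (h20 : ∀ (F : T4Family) (θ : Stage13HParams F N) (hP : θ.Provisos₁₃CoPH F N), Rg F θ → θ.Admissible F N →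
      ∀ (g₀ : ℕ → ℝ) (os : List (ULoop F)),
        ∃ W : ℕ → ℝ, RelWeightBound 1 (classSet₁₃ θ K₀ g₀) (weightA₁₃ θ hP K₀ g₀ os) (weightB₁₃ θ hP K₀ g₀ os) (badClass₁₃ θ K₀ g₀ (jc F θ hP g₀ os)) W)
    (h21 : ∀ (F : T4Family) (θ : Stage13HParams F N) (hP : θ.Provisos₁₃CoPH F N), Rg F θ → θ.Admissible F N →
      ∀ (g₀ : ℕ → ℝ) (os : List (ULoop F)),
        ∃ Wsh : ℕ → ℝ, ShellWeightBound 1 (classSet₁₃ θ K₀ g₀) (weightA₁₃ θ hP K₀ g₀ os) (weightB₁₃ θ hP K₀ g₀ os) (sh F θ hP g₀ os).1 (sh F θ hP g₀ os).2 Wsh)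
    (hlink : ∀ (F : T4Family) (θ : Stage13HParams F N) (hP : θ.Provisos₁₃CoPH F N), Rg F θ → θ.Admissible F N →
      ∀ (γ gIR b : ℝ) (g₀ : ℕ → ℝ), (datumOfRecord₁₃CoPH F N θ hP).Tuned γ gIR g₀ → γ ≤ θ.γ → γ ^ 2 ≤ Real.exp (-1) → 0 < b →
      (∀ K m, 0 ≤ m → m < K → b ≤ (datumOfRecord₁₃CoPH F N θ hP).βfun m (prefixOf (runFlow (datumOfRecord₁₃CoPH F N θ hP) g₀ K) m)) →
      ∀ (os : List (ULoop F)) (k : ℕ),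
        let S : SpineCarriers := crOfRecord₁₃VAt K₀ (jc F θ hP g₀ os) sh F θ hP g₀ os
        let R : RateCarriers N := rateCarriersOfRecord₁₃CoPH 𝔯 F θ hP g₀ os k
        let D : Datum F N := datumOfRecord₁₃CoPH F N θ hP
        letI := S.dec
        ∃ (_ : DecidableEq R.u3.C.Dom) (F' : Type) (ι' X' : Type) (_ : MeasurableSpace ι')
          (L : LedgerDataSync R.u3.C F' ι' S.ι) (Rd : Readings ι' X') (bsel : (ℕ → ℝ) → ℝ) (EB : Functional R.u3.C R.u3.C.BgB)
          (θc θ₃ : ℝ) (g : ℕ → ℕ → ℝ)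
          (uA : ℕ → ι' → R.u3.C.BgA) (uB : ℕ → ι' → R.u3.C.BgB)
          (Pf : ℕ → Params) (d₀ L₀ Koff : ℕ) (cells : (K j : ℕ) → R.u3.C.Dom → Finset (Site (Pf K) j))
          (H033 : Flow → ℕ → Prop) (I : Type) (fam : I → B14.Sect2Data) (Lb βw : ℝ) (κ₁ : ℕ) (Gv Cl : ℝ) (K₁ : ℕ)
          (Λ₀ N₀ : ℝ) (dressed : R.u3.C.Dom → Prop) (_ : DecidablePred dressed)
          (c' t θ γ₃ l₁ : ℝ)
          (sel : ℕ → (B7Prop1Explicit.Site 4 → Fin 4 → (Matrix (Fin N) (Fin N) ℂ)ˣ) → (B7Prop1Explicit.Site 4 → Fin 4 → (Matrix (Fin N) (Fin N) ℂ)ˣ))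
          (rd : ι' → (B7Prop1Explicit.Site 4 → Fin 4 → (Matrix (Fin N) (Fin N) ℂ)ˣ)) (k₀ : ℕ)
          (E₀T κ₁T C₁T : ℝ) (q₁ : ℕ),
          (∀ K i, i ≤ K → g K i = runFlow D g₀ K i) ∧ (∀ K i, K < i → g K i = gIR) ∧
          EB = (fun s => R.u3.EB (bsel s) s) ∧
          (∀ (Sz : ℕ → ℝ → S.ι → ℕ → ℝ) (E₀ : ℝ) (m : ℕ) (a : ℝ) (Cw Λg : ℝ),
            (∀ K t, |t| ≤ S.l₀ → ∀ τ ∈ S.T K \ S.Bad K t, ∀ v ∈ Rd.dom, ∀ j ≤ K,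
              |∑ X ∈ L.fac K t τ with R.u3.C.scale X = j,
                  (Real.log (Real.exp (EB (fun i => g (K + 1) (i + 1)) (uB K v) X
                      - EB (fun i => g (K + 1) (i + 1)) L.oneB X))
                    - Real.log (Real.exp (R.u3.EA (g K) (uA K v) X - R.u3.EA (g K) L.oneA X)))| ≤ Sz K t τ j) →
            0 ≤ E₀ → 0 < a → a < 1 →
            (∀ K t, |t| ≤ S.l₀ → ∀ τ ∈ S.T K \ S.Bad K t, ∀ j ≤ K,
              Sz K t τ j ≤ S.vol * (E₀ * ((K : ℝ) + 1) ^ m * a ^ (K - j))) →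
            (∀ K, Multiplicity (L.All K) R.u3.C.scale (fun X => Real.exp (-(R.u3.κ * R.u3.C.d X))) Cw S.vol Λg K) →
            (∀ K t, |t| ≤ S.l₀ → ∀ τ ∈ S.T K \ S.Bad K t,
              WindowMultiplicity (L.facO K t τ) L.scO L.wO Cw S.vol Λg (jlogOf L.Cl K) K) →
            1 ≤ Λg → L.θ' ≤ Λg →
            LedgerAtSync { L with S := Sz, E₀ := E₀, m := m, a := a, Cw := Cw, Λg := Λg } S.l₀ S.vol S.T S.Bad
              (fun K t τ => S.A K t τ - S.shA K t τ) (fun K t τ => S.B K t τ - S.shB K t τ) Rd R.u3.EA EB R.u3.κ g uA uB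
              R.u3.ω θc R.u3.θ θ₃) ∧
          0 ≤ S.vol ∧
          (∀ K t, |t| ≤ S.l₀ → ∀ τ ∈ S.T K \ S.Bad K t,
            WindowMultiplicity (L.facO K t τ) L.scO L.wO L.Cw S.vol L.Λg (jlogOf L.Cl K) K) ∧
          0 ≤ L.Cw ∧ 1 ≤ L.Λg ∧ L.θ' ≤ L.Λg ∧
          (∀ K, (Pf K).d = d₀) ∧ (∀ K, (Pf K).L = L₀) ∧ (∀ K, (Pf K).K = Koff + K) ∧
          (∀ K, (Fintype.card (Site (Pf K) (Pf K).K) : ℝ) = S.vol) ∧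
          kappa₀ (4 * 2 ^ d₀) (2 * d₀) ≤ R.u3.κ ∧
          (∀ K, ∀ X ∈ L.All K,
            (cells K (R.u3.C.scale X + Koff) X).Nonempty ∧ TFaceConnected (cells K (R.u3.C.scale X + Koff) X)) ∧
          (∀ K j, Set.InjOn (cells K j) ↑((L.All K).filter fun X => R.u3.C.scale X + Koff = j)) ∧
          (∀ K, ∀ X ∈ L.All K, torusTreeLen (cells K (R.u3.C.scale X + Koff) X) ≤ R.u3.C.d X) ∧
          B14.Thm2Printed H033 fam Lb βw κ₁ ∧ βw < 1 ∧ 0 < βw ∧ 1 < Lb ∧ 1 ≤ Gv ∧ 0 ≤ Cl ∧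
          (∀ p K, (R.ne1.𝒯.B p K).PositionalCount fun j k => N₀ * Λ₀ ^ (k - j)) ∧ 0 ≤ N₀ ∧ 0 ≤ Λ₀ ∧ Λ₀ ≤ R.ne1.Λ ∧
          (∀ K t, |t| ≤ S.l₀ → ∀ τ ∈ S.T K \ S.Bad K t, ∀ v ∈ Rd.dom, ∀ j ≤ K, ∃ (i : I) (w : (fam i).Ω) (j' : ℕ),
            (fam i).flow.SatisfiesRG (fam i).K ∧ H033 (fam i).flow (fam i).K ∧ 1 ≤ j' ∧ j' ≤ (fam i).K ∧
            (fam i).K - j' = K - j ∧ (fam i).K ≤ K + K₁ ∧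
            (∀ n, 0 ≤ (fam i).gammaVol n w) ∧ (fam i).gammaVol (fam i).K w ≤ S.vol ∧
            (∀ n, n < (fam i).K → n < jlogOf Cl (fam i).K → (fam i).gammaVol n w = 0) ∧
            (∀ n, n < (fam i).K → jlogOf Cl (fam i).K ≤ n → (fam i).gammaVol n w ≤ S.vol * Gv ^ ((fam i).K - n)) ∧
            |∑ X ∈ (L.fac K t τ).filter (fun X => ¬ dressed X) with R.u3.C.scale X = j,
                (R.u3.EA (g K) (uA K v) X - R.u3.EA (g K) L.oneA X)| ≤ |(fam i).eTerm j' (fam i).K w|) ∧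
          (∀ K t, |t| ≤ S.l₀ → ∀ τ ∈ S.T K \ S.Bad K t, ∀ v ∈ Rd.dom, ∀ j ≤ K, ∃ (i : I) (w : (fam i).Ω) (j' : ℕ),
            (fam i).flow.SatisfiesRG (fam i).K ∧ H033 (fam i).flow (fam i).K ∧ 1 ≤ j' ∧ j' ≤ (fam i).K ∧
            (fam i).K - j' = K - j ∧ (fam i).K ≤ K + K₁ ∧
            (∀ n, 0 ≤ (fam i).gammaVol n w) ∧ (fam i).gammaVol (fam i).K w ≤ S.vol ∧
            (∀ n, n < (fam i).K → n < jlogOf Cl (fam i).K → (fam i).gammaVol n w = 0) ∧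
            (∀ n, n < (fam i).K → jlogOf Cl (fam i).K ≤ n → (fam i).gammaVol n w ≤ S.vol * Gv ^ ((fam i).K - n)) ∧
            |∑ X ∈ (L.fac K t τ).filter (fun X => ¬ dressed X) with R.u3.C.scale X = j,
                (EB (fun i => g (K + 1) (i + 1)) (uB K v) X - EB (fun i => g (K + 1) (i + 1)) L.oneB X)|
              ≤ |(fam i).eTerm j' (fam i).K w|) ∧
          (∀ K t, |t| ≤ S.l₀ → ∀ τ ∈ S.T K \ S.Bad K t, ∀ v ∈ Rd.dom,
            ∃ (pA : R.ne1.P) (βA : R.u3.C.Dom → (R.ne1.𝒯.B pA K).Birth) (Q : Finset (R.ne1.𝒯.B pA K).Cube) (pB : R.ne1.P)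
              (KB : ℕ) (βB : R.u3.C.Dom → (R.ne1.𝒯.B pB KB).Birth),
            (∀ X ∈ (L.fac K t τ).filter (fun X => dressed X), (R.ne1.𝒯.B pA K).birthScale (βA X) = R.u3.C.scale X) ∧
            (∀ j, Set.InjOn βA ↑(((L.fac K t τ).filter (fun X => dressed X)).filter fun X => R.u3.C.scale X = j)) ∧
            (∀ c ∈ Q, (R.ne1.𝒯.B pA K).cubeScale c = K) ∧ ((Q.card : ℝ) ≤ S.vol) ∧
            (∀ X ∈ (L.fac K t τ).filter (fun X => dressed X), ∃ c ∈ Q, βA X ∈ (R.ne1.𝒯.B pA K).feltAt c) ∧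
            (∀ X ∈ (L.fac K t τ).filter (fun X => dressed X), KB - (R.ne1.𝒯.B pB KB).birthScale (βB X) = K - R.u3.C.scale X) ∧
            (∀ X ∈ (L.fac K t τ).filter (fun X => dressed X),
              |R.u3.EA (g K) (uA K v) X - R.u3.EA (g K) L.oneA X| ≤ (R.ne1.𝒯.B pA K).size (βA X) K) ∧
            (∀ X ∈ (L.fac K t τ).filter (fun X => dressed X),
              |EB (fun i => g (K + 1) (i + 1)) (uB K v) X - EB (fun i => g (K + 1) (i + 1)) L.oneB X|
                ≤ (R.ne1.𝒯.B pB KB).size (βB X) KB)) ∧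
          R.ne3.g = gradConst 4 c' ∧ 0 ≤ c' ∧ R.ne3.b ≤ t ∧ c' ≤ t ∧
          (2 : ℝ) ^ 91 * (R.ne3.L : ℝ) ^ 17 * t ≤ 1 ∧ (2 : ℝ) ^ 76 * (R.ne3.L : ℝ) ^ 12 * t ≤ R.ne3.ε ∧
          16 * B7Prop2Explicit.C0 4 * R.ne3.ε ≤ 3 ∧ 1024 * (4 + 1) * (4 + 4) * (R.ne3.L : ℝ) ^ 2 * R.ne3.ε ≤ 1 ∧
          4 * ((ℓ₃ F).ε / B F) ≤ c' ∧
          LeafH3sup 4 R.ne3.L R.ne3.Nper R.ne3.ε R.ne3.b c' R.ne3.dom ∧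
          (∀ V ∈ R.ne3.dom, ∀ k : ℕ, IsMinimiser 4 (sfClass 4 R.ne3.L R.ne3.Nper R.ne3.ε) R.ne3.L R.ne3.Nper k V (sel k V)) ∧
          (∀ V ∈ R.ne3.dom, ∀ k : ℕ, RegularSup 4 R.ne3.L R.ne3.Nper R.ne3.b c' k (sel k V)) ∧
          0 < θ ∧ θ ^ 6 = ((R.ne3.L : ℝ))⁻¹ ∧ 0 < γ₃ ∧
          R.ne3.C * (wallConst 4 R.ne3.L * (R.ne3.Nper : ℝ) ^ 2 *
            (Real.sqrt (gradConst 4 c') * dualC2 4 R.ne3.L + 2 * R.ne3.b ^ 2 * dualC1 4 R.ne3.L)) ≤ γ₃ ^ 3 ∧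
          0 < l₁ ∧ R.ne3.Λ₁ ≤ l₁ ^ 3 ∧ γ₃ * θ ^ 2 ≤ l₁ * R.ne3.Nper ∧ θ ^ ((3 : ℝ) * β - 2) ≤ θ₃ ∧ θ₃ < 1 ∧
          (∀ v ∈ Rd.dom, rd v ∈ R.ne3.dom) ∧
          (∀ k, ∀ v ∈ Rd.dom, Rd.act k v = minAct 4 (sfClass 4 R.ne3.L R.ne3.Nper R.ne3.ε) R.ne3.L R.ne3.Nper k (rd v)) ∧
          (R.ne3.Nper : ℝ) ^ 4 ≤ Rd.vol ∧ 1 ≤ k₀ ∧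
          (∀ K : ℕ, ∀ v ∈ Rd.dom, ∀ (u : B7Prop1Explicit.Site 4 → (Matrix (Fin N) (Fin N) ℂ)ˣ)
            (Z : B7Prop1Explicit.Site 4 → Fin 4 → Matrix (Fin N) (Fin N) ℂ) (M : ℝ),
            IsUnitarySite u → IsPeriodicSite u ((R.ne3.Nper * R.ne3.L ^ (k₀ + K) : ℕ) : ℤ) → T4AveragingDeficitWall.IsSkewDir Z →
            IsPeriodicDir Z ((R.ne3.Nper * R.ne3.L ^ (k₀ + K) : ℕ) : ℤ) →
            B7Prop1Explicit.gaugeAct u (sel (k₀ + K) (rd v)) =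
              T4AveragingDeficitWall.vary (B7Prop2Explicit.rescale R.ne3.L (B7Prop1Explicit.bavg R.ne3.L (sel (k₀ + K + 1) (rd v)))) Z 1 →
            (∀ (x : B7Prop1Explicit.Site 4) (κ : Fin 4), (R.ne3.L : ℝ) ^ (k₀ + K) * ‖Z x κ‖ ≤ M) →
            (∀ (x : B7Prop1Explicit.Site 4) (μ κ : Fin 4), ((R.ne3.L : ℝ) ^ (k₀ + K)) ^ 2 *
                ‖T4AveragingDeficitWall.Ad (B7Prop2Explicit.rescale R.ne3.L (B7Prop1Explicit.bavg R.ne3.L (sel (k₀ + K + 1) (rd v)))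
                    (x + B7Prop1Explicit.e κ) μ) (Z (x + B7Prop1Explicit.e μ) κ) - Z x κ‖ ≤ M) →
            R.u3.C.gauge (uA K v) (R.u3.C.transport (uB K v)) ≤ M) ∧
          R.u3.ρ ≤ θc ∧
          DecayBound R.u3.EA (Window γ) E₀T R.u3.κ ∧
          (∀ s ∈ Window γ, ∀ (X : R.u3.C.Dom) (U U' : R.u3.C.BgA),
            R.u3.C.gauge U U' < κ₁T * B14.alphaJ C₁T q₁ (s (R.u3.C.scale X)) →
            ∃ f : ℂ → ℂ, DifferentiableOn ℂ f (Metric.ball (0 : ℂ) (κ₁T * B14.alphaJ C₁T q₁ (s (R.u3.C.scale X)))) ∧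
              f 0 = (R.u3.EA s U X : ℂ) ∧ f (R.u3.C.gauge U U' : ℂ) = (R.u3.EA s U' X : ℂ) ∧
              ∀ z ∈ Metric.ball (0 : ℂ) (κ₁T * B14.alphaJ C₁T q₁ (s (R.u3.C.scale X))),
                ‖f z‖ ≤ E₀T * Real.exp (-(R.u3.κ * R.u3.C.d X))) ∧
          0 ≤ E₀T ∧ 0 < κ₁T ∧ 0 < C₁T ∧
          (∀ s ∈ Window γ, 0 < bsel s ∧ bsel s ≤ γ)) :
    Spine (N := N) fun F D w => Node00.IsRecordOfRecord₁₃CCoPHOn F N Rg D w := by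
  have hU := fun (F : T4Family) (θ : Stage13HParams F N) (hP : θ.Provisos₁₃CoPH F N) (hRg : Rg F θ) (hθ : θ.Admissible F N) =>
    u3KernelInputs_of_finiteVolumeLetters F N θ.toStage13Params (ℓ F θ) (hs F θ hP hRg hθ) (s F θ) (hr F θ hP hRg hθ) (hinc F θ hP hRg hθ) (hS F θ hP hRg hθ)
      (h9 F θ hP hRg hθ) (hW F θ hP hRg hθ)
  exact (spine_rec13CCoPHOn_iff_forall_guarded Rg).mpr <|
    keyedGuarded₁₃CoPH_of_keyedFacesP_fsc (fun F θ hP g₀ os => crOfRecord₁₃VAt K₀ (jc F θ hP g₀ os) sh F θ hP g₀ os)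
      (fun F θ hP g₀ os => rateCarriersOfRecord₁₃CoPH 𝔯 F θ hP g₀ os (ksel F θ hP g₀ os)) (fun θ => Rg _ θ)
      (fun D R => RatesHolderAt D R β ∧ ReadOutAt D R.u3 ∧ (0 ≤ R.u3.ρ ∧ R.u3.ρ < 1))
      (fun F θ hP hRg hθ g₀ os => by
        obtain ⟨W, hW⟩ := h20 F θ hP hRg hθ g₀ os
        exact relWeightBound_crOfRecord₁₃VAt K₀ (jc F θ hP g₀ os) sh θ hP g₀ os hW)
      (fun F θ hP hRg hθ g₀ os => by
        obtain ⟨Wsh, hWsh⟩ := h21 F θ hP hRg hθ g₀ os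
        exact shellWeightBound_crOfRecord₁₃VAt K₀ (jc F θ hP g₀ os) sh θ hP g₀ os hWsh)
      (fun F θ hP hRg hθ _ _ => ForSmallCouplings.of_forall fun g₀ os =>
        pHolderD4Body_rateCarriers_of_kernels_pin 𝔯 θ hP g₀ os (ℓ F θ) (hpin F θ hP g₀ os) β (ksel F θ hP g₀ os)
          (n14At_rateCarriersOfRecord₁₃CoPH_of_pinned 𝔯 hpin1 F θ hP g₀ os (ksel F θ hP g₀ os))
          (by
            obtain ⟨b, aS, ν, μ, α, β', c35, p, hb, haS, h⟩ := hpin2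
            rw [h F θ hP g₀ os]
            exact n15At_fullGSizedObjects_family hb haS ν μ α β' c35 p F)
          (by
            show N16HolderAt (rateCarriersOfRecord₁₃CoPH 𝔯 F θ hP g₀ os (ksel F θ hP g₀ os)).ne3 β
            rw [rateCarriers_ne3_of_pinnedLoose hpinL F θ hP g₀ os (ksel F θ hP g₀ os)]
            exact h16 F ⟨θ, hP, hRg, hθ⟩)
          (hs F θ hP hRg hθ) (hκ F θ hP hRg hθ) (hcr F θ hP hRg hθ) (hρ F θ hP hRg hθ) (hU F θ hP hRg hθ).1 ((hU F θ hP hRg hθ).2.1 _)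
          ((hU F θ hP hRg hθ).2.2 _))
      (keyedCoreEdgeHolderD4_of_linkReadingAtN16PinnedReading (fun F θ hP g₀ os => crOfRecord₁₃VAt K₀ (jc F θ hP g₀ os) sh F θ hP g₀ os) 𝔯 (fun θ => Rg _ θ) hβ1 hlink
        hpinL hmatch hend ksel hβw hunif)
      (fun F θ hP hRg hθ _ _ => by
        obtain ⟨E, hE⟩ := hsel F θ hP hRg hθ
        exact keyedExtraction_crOfRecord₁₃VAt_cut K₀ jc sh θ hP E hE (localBgMeasurable F N θ.ν) (hζm F θ hP hRg hθ) (zeta_nonneg_of_provisos₁₃CoPH F θ hP))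

end Summit.QuantumFields.YangMills.Theorems.BalabanUVNodesN27SpineRecord
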